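import Summits.ResolutionOfSingularities.ResolutionOfSingularities.Theorems.DeltaCutStellarLatGuard
import Summits.ResolutionOfSingularities.ResolutionOfSingularities.Theorems.DeltaCutStellarJetLaw

/-!
# StellarCut L20d — «LatentCut»: the LATENT LAW (weak order reduction for Artin–Schreier stages by codimension-two hops), the
# latent class `IsNCHypStageLat`, the cells `WORNCHypWildLat` / `WORNCHypWildRest3` and the exact carve of `WORNCHypWildRest2`
# (lens-6 «barrier-complement carving», g36; column item `E1TopNoAbs`)

THE LAW.  A `ncHypShapeLat p`-datum (L20a: `𝓘_y = (hᵖ + v(h − c m_μ) m_b m_μ^{p−1})` along `V(H)`, terminal labels `E` coprime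
to `p`, latent labels `L`) admits a weak resolution, by strong induction on the LATENT MASS `latMass L H` (L20a):
mass `0` ⇒ the shape IS T18's coprime shape (`ncHypShapeLat.toCop`), hence jet-certified (`ncHypShapeCop.toJet`), and the JET
LAW resolves it (`exists_weakResolution_of_ncHypShapeJet`, T19b-iii, BY NAME); mass `> 0` ⇒ some latent member `K` meets `V(H)` with `expOf L K ≥ 1`, the
codimension-two face `V(H) ∩ V(K)` is permissible (`support_pair_subset`) and regular, its blow-up is again Artin–Schreier
(L20c `ncHypShapeLat.transform` — the new fibre guard) and the mass drops (`latMass_transform_lt`).  This is a NEW strategy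
(codimension-two latent hops first, weight-≥-`p` faces after), not T16's.

THE CLASS AND THE CARVE.  `IsNCHypStageLat p N`: an s.n.c. frame `F` with a latent label vector `μ` presenting `𝓘` in the LATENT
shape along `H` (`NCFrame.LatShape`), `SuppLE p`, terminal labels `0` or prime to `p`.  The cell `WORNCHypWildLat n` = the binders
of `WORNCHypWildRest2 n` (T19) verbatim PLUS `p = n ∧ IsNCHypStageLat p`; `WORNCHypWildRest3 n` = the same binders PLUS its
negation; `worNCHypWildRest2_iff_lat_rest3 : Rest2 n ⟺ Lat n ∧ Rest3 n` is pure logic (exact, hyp-free).  THE LAT CELL IS DECIDED ·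
HOLDS (`worNCHypWildLat_holds`, every `n ≥ 1`; `worNCHypWildLat_all`, every `n`), whence `Rest2 n ⟺ Rest3 n` and the column's located residual becomes `E1NCHypWildRest3`.
Natural inhabitants: the kangaroo `x² + (1 + x)z²w²` over `𝔽₂` = `X² + (X + zw)·zw·zw` in the frame `(X = x + zw; z, w)`
(latent labels `(1,1)`, terminal labels `(1,1)`, two hops; KERNEL, L20e), and the census member `x² + (1 + x + x²)z⁶w⁶`
(`μ = (3,3)`, `b = (3,3)`; desk; I182 T-jethunt OPEN@12).

B = `WORNCHypWildRest3` IS TYPED WITH TEST DATA, three families: (i) the six Artin–Schreier-presentable data over `𝔽₂` with an EVEN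
terminal label — Hauser's `x² + (1+xz)z²w²` (`μ = (1,1)`, `b = (2,1)`), `x² + (1+x+z)z²w²` (`b = (1,2)`), the census data (2,4)
`1+x²+xz` (`b = (2,2)`), (4,4) `1+x+x²` (`b = (2,2)`), (4,4) `1+x²+xz` (`b = (3,2)`), (6,6) `1+x²+xw` (`b = (3,4)`) — tag IDEA-NEEDED
«LatJet» (latent hops + a transported diagonal log derivation); (ii) `x² + (1+z³+w³)z²w² = (x+zw)² + z²w²(z³+w³)` — binomial, non-jet, NOT
Artin–Schreier-monomial (h-free cubic tail) — tag IDEA-NEEDED «polynomial-tail completion»; (iii) the composite-marking family `n = p·m`,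
`m ≥ 2` (label datum `n = 4`, `p = 2`, `(3,3) ↦ 2 ↦ (2,2)`) — tag UNDECIDED, no class proposed.  A is NOT claimed to exhaust
`WORNCHypWildRest2` at `p = n`.

* `NCFrame.relabel`, `NCFrame.LatShape`, `IsNCHypStageLat` — the frame-level class;
* `exists_weakResolution_of_ncHypShapeLat` — ★★ the list-level latent law;
* `exists_ncHypShapeLat_of_isNCHypStageLat` — the bridge from the binders; `worLatent_holds` — the hyp-free frame-level law;
* `WORNCHypWildLat`, `WORNCHypWildRest3`, `worNCHypWildRest2_iff_lat_rest3`, `worNCHypWildLat_holds` (`_all`), `worNCHypWildRest2_iff_rest3`,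
  families `E1NCHypWildLat` / `E1NCHypWildRest3` and the column rewires.

0 sorry; axioms standard. [new] [cite: CossartPiltant2008, Prop. 4.2] [cite: Kollar2007, (3.111) Step 3] [cite: Hauser2010, §§3–5]
-/
noncomputable section

open CategoryTheory CategoryTheory.Limits AlgebraicGeometry TopologicalSpace IsLocalRing
open Literature.AlgebraicGeometry.Resolution

namespace Summit.ResolutionOfSingularities.ResolutionOfSingularities.Theorems.DeltaCutClasses

open Summit.ResolutionOfSingularities.ResolutionOfSingularities.Theorems
open WeakOrderReduction ForcedTowerClasses

/-! ### §ListLaw — weak order reduction for the Artin–Schreier shape, by latent hops -/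

section ListLaw

open Classical in
/-- a positive latent mass exhibits a latent entry meeting `V(H)` with a positive label -/
theorem exists_entry_of_latMass_ne_zero {X : Scheme.{0}} {L : List (X.IdealSheafData × ℕ)} {H : X.IdealSheafData}
    (h0 : latMass L H ≠ 0) : ∃ q ∈ L, ((q.1.support : Set X) ∩ H.support).Nonempty ∧ 1 ≤ q.2 := by
  by_contra hno
  push Not at hno
  refine h0 (List.sum_eq_zero fun x hx => ?_)
  obtain ⟨q, hq, rfl⟩ := List.mem_map.mp hx
  by_cases hne : ((q.1.support : Set X) ∩ H.support).Nonempty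
  · have := hno q hq hne
    simp only [if_pos hne]
    omega
  · simp only [if_neg hne]

open Classical in
/-- an entry's label is bounded by the exponent of its divisor -/
theorem label_le_expOf {X : Scheme.{0}} {L : List (X.IdealSheafData × ℕ)} {q : X.IdealSheafData × ℕ} (hq : q ∈ L) :
    q.2 ≤ expOf L q.1 := by
  have hmem : q.2 ∈ L.map (fun q' : X.IdealSheafData × ℕ => if q'.1 = q.1 then q'.2 else 0) :=
    List.mem_map.mpr ⟨q, hq, if_pos rfl⟩
  rw [← sum_map_ite_eq_expOf L q.1]
  exact List.single_le_sum (fun _ _ => Nat.zero_le _) _ hmem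

/-- ★★ **THE LIST-LEVEL LATENT LAW** (strong induction on the latent mass): on a locally Noetherian scheme, a `ncHypShapeLat p`-datum
for a labelled boundary `E ∋ H` with `H :: ∂E` s.n.c. admits a weak resolution — latent hops at codimension-two faces `V(H) ∩ V(K)`
while the mass is positive (L20c), then — mass `0` = T18's coprime shape ⊆ T19's jet shape — the JET LAW
`exists_weakResolution_of_ncHypShapeJet` (T19b-iii) BY NAME. [new] [cite: CossartPiltant2008, Prop. 4.2] [cite: Kollar2007, (3.111) Step 3] -/
theorem exists_weakResolution_of_ncHypShapeLat {p : ℕ} : ∀ (N : ℕ) {X : Scheme.{0}} [IsLocallyNoetherian X]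
    {E L : List (X.IdealSheafData × ℕ)} {H : X.IdealSheafData} (M : MarkedIdeal X), latMass L H = N →
      HasSNC (H :: boundaryOf E) → H ∈ boundaryOf E → ncHypShapeLat p X E L H M → ∃ s : CentreSeq X, WeakResolution s M := by
  intro N
  induction N using Nat.strong_induction_on with
  | _ N ih =>
  intro X _ E L H M hN hEs hH hP
  by_cases h0 : latMass L H = 0
  · -- terminal: the coprime shape is jet-certified (T19b `ncHypShapeCop.toJet`); the JET LAW by name (T19b-iii)
    exact exists_weakResolution_of_ncHypShapeJet hEs hH M (hP.toCop h0).toJet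
  · -- a latent hop at `V(H) ∩ V(K)`
    obtain ⟨q, hq, hne, hq1⟩ := exists_entry_of_latMass_ne_zero h0
    have hK : q.1 ∈ boundaryOf E := hP.boundaryOf_eq ▸ fst_mem_boundaryOf hq
    have hLK : 1 ≤ expOf L q.1 := hq1.trans (label_le_expOf hq)
    have hHK : H ≠ q.1 := by
      intro hHK
      rcases hP.labelL hq hHK.symm with h | h
      · omega
      · have hne' := hne.mono Set.inter_subset_right
        rw [h] at hne'
        exact Set.not_nonempty_empty hne'
    have hne' : ((q.1.support : Set X) ∩ H.support).Nonempty := hne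
    have hT : ∀ K' ∈ pairFace H q.1, K' ∈ H :: boundaryOf E := pair_subset_frame hK
    have hπ := blowup.isBlowup ((pairFace H q.1).sup id)
    haveI : IsProper (blowup.π ((pairFace H q.1).sup id)) := hπ.isProper
    haveI : IsLocallyNoetherian (blowup ((pairFace H q.1).sup id)) :=
      LocallyOfFiniteType.isLocallyNoetherian (blowup.π ((pairFace H q.1).sup id))
    have hP' := hP.transform hEs hK hHK hπ hLK
    have hEs' := hasSNC_ncShape_transform hEs hT hπ 0
    have hH' : strictTransformIdeal (blowup.π ((pairFace H q.1).sup id)) ((pairFace H q.1).sup id) H ∈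
        boundaryOf (transformExp E (blowup.π ((pairFace H q.1).sup id)) (pairFace H q.1) 0) := by
      rw [boundaryOf_transformExp]
      exact List.mem_append_left _ (List.mem_map.mpr ⟨H, hH, rfl⟩)
    have hlt := hP.latMass_transform_lt hEs hK hHK hπ hLK hne'
    rw [hN] at hlt
    obtain ⟨rest, hrest⟩ := ih _ hlt (M.transform (blowup.π ((pairFace H q.1).sup id)) ((pairFace H q.1).sup id)) rfl hEs' hH' hP'
    exact ⟨.cons ((pairFace H q.1).sup id) rest,
      ⟨hP.support_pair_subset hLK, hEs.isRegular_subscheme_finsetSup _ hT, hrest.1⟩, hrest.2⟩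

/-- ★★ the latent law, mass unquantified. [new] -/
theorem ncHypShapeLat.exists_weakResolution {p : ℕ} {X : Scheme.{0}} [IsLocallyNoetherian X]
    {E L : List (X.IdealSheafData × ℕ)} {H : X.IdealSheafData} {M : MarkedIdeal X} (hP : ncHypShapeLat p X E L H M)
    (hEs : HasSNC (H :: boundaryOf E)) (hH : H ∈ boundaryOf E) : ∃ s : CentreSeq X, WeakResolution s M :=
  exists_weakResolution_of_ncHypShapeLat (latMass L H) M rfl hEs hH hP

end ListLaw

/-! ### §Class — the frame-level latent class -/

section Class

open AlgebraicGeometry.Scheme.IdealSheafData (vanishingIdeal)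

/-- **the frame with its labels replaced** by `μ` (same `H`, same `Dᵢ`). DEFINITION. [folklore] -/
def NCFrame.relabel {N : Stage} (F : NCFrame N) (μ : Fin F.r → ℕ) : NCFrame N := ⟨F.H, F.r, F.D, μ⟩

/-- relabelling keeps the s.n.c. configuration -/
theorem NCFrame.IsSNC.relabel {N : Stage} {F : NCFrame N} (hS : F.IsSNC) (μ : Fin F.r → ℕ) : (F.relabel μ).IsSNC := hS

/-- **`F.LatShape p μ` — THE LATENT (ARTIN–SCHREIER) SHAPE of an n.c. frame** on the stage `N = (Y, 𝓘)` with latent label vector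
`μ`: at every `y ∈ H`, `𝓘_y = (hᵖ + v·(h − c·m_μ)·m_b·m_μ^{p−1})` with `𝓘(H)_y = (h)`, `(Π 𝓘(Dᵢ)^{aᵢ})_y = (m_b)`,
`(Π 𝓘(Dᵢ)^{μᵢ})_y = (m_μ)`, `c, v ∈ 𝒪_y^×`.  (`μ = 0` is the coprime binomial shape with unit `v(h − c)`; the kangaroo
`x² + (1 + x)z²w² = X² + (X − zw)·zw·zw`, `X = x + zw`, has `μ = (1,1)`.) DEFINITION (letter · the «LatentCut» class). [new]
[cite: CossartPiltant2008, Prop. 4.2] [cite: Hauser2010, §3] -/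
def NCFrame.LatShape (p : ℕ) {N : Stage} (F : NCFrame N) (μ : Fin F.r → ℕ) : Prop :=
  ∀ y : N.Y, y ∈ (F.H : Set N.Y) →
    ∃ h mb mμ c v : N.Y.presheaf.stalk y, IsUnit c ∧ IsUnit v ∧ stalkIdeal (vanishingIdeal F.H) y = Ideal.span {h} ∧
      stalkIdeal F.boundary y = Ideal.span {mb} ∧ stalkIdeal (F.relabel μ).boundary y = Ideal.span {mμ} ∧
      stalkIdeal N.I y = Ideal.span {h ^ p + v * (h - c * mμ) * mb * mμ ^ (p - 1)}

/-- **`IsNCHypStageLat p N` — LATENT-CONTACT n.c. stage at the pure-characteristic marking `p`**: an s.n.c. frame with a latent label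
vector in the latent shape, top locus on `H` (`SuppLE p`), terminal labels `0` or prime to `p`. DEFINITION (letter · the latent class).
[new] -/
def IsNCHypStageLat (p : ℕ) (N : Stage) : Prop :=
  ∃ (F : NCFrame N) (μ : Fin F.r → ℕ), F.IsSNC ∧ F.LatShape p μ ∧ F.SuppLE p ∧ ∀ i, F.a i = 0 ∨ ¬ p ∣ F.a i

/-- the boundary lists of a frame and of its relabelling agree -/
theorem NCFrame.boundaryOf_expList_relabel {N : Stage} (F : NCFrame N) (μ : Fin F.r → ℕ) :
    boundaryOf (F.relabel μ).expList = boundaryOf F.expList := by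
  simp only [boundaryOf, NCFrame.expList, NCFrame.relabel, List.map_ofFn]
  rfl

/-- **the label clause of a frame list**: the head `(𝓘(H), 0)` carries `0` and no `𝓘(Dᵢ)` equals `𝓘(H)` (T17b's block). [folklore] -/
theorem NCFrame.IsSNC.label_cons_expList {N : Stage} {F : NCFrame N} (hS : F.IsSNC) :
    ∀ q ∈ (vanishingIdeal F.H, 0) :: F.expList, q.1 = vanishingIdeal F.H →
      q.2 = 0 ∨ ((vanishingIdeal F.H).support : Set N.Y) = ∅ := by
  intro q hq hqH
  rcases List.mem_cons.mp hq with rfl | hq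
  · exact Or.inl rfl
  · exfalso
    obtain ⟨i, hi⟩ := F.mem_boundaryOf_expList_iff.mp (fst_mem_boundaryOf hq)
    have hset : ((F.D i : Closeds N.Y) : Set N.Y) = (F.H : Set N.Y) := by
      rw [← Scheme.IdealSheafData.coe_support_vanishingIdeal (Z := F.D i), ← hi, hqH,
        Scheme.IdealSheafData.coe_support_vanishingIdeal]
    exact hS.2.2.2.2.1 i hset.le

end Class

/-! ### §Cells — the latent cell, the new remainder, the exact carve -/

section Cells

/-- **`WORNCHypWildLat n` — THE LATENT CELL**: the binders of `WORNCHypWildRest2 n` (T19) VERBATIM, PLUS `p = n` and a latent-contact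
frame (`IsNCHypStageLat p`).  DECIDED · HOLDS (`worNCHypWildLat_holds`; `worNCHypWildLat_all` at every `n`).  Kernel-inhabited (L20e): the
kangaroo `x² + (1 + x)z²w²` over `𝔽₂` (latent mass `2`: two codimension-two hops, then the coprime labels `(1,1)`); not the jet /
coprime / tame class in a costume (the kangaroo admits NO jet datum at the origin, T19d, and its binomial labels `(2,2)` are even).
[new] [cite: Hauser2010, §§3–5] -/
def WORNCHypWildLat (n : ℕ) : Prop :=
  ∀ p : ℕ, p.Prime → ∀ (k : Type) [Field k] [CharP k p] (Y : Scheme.{0}) (g : Y ⟶ Spec (.of k)),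
    IsBase Y g → p ∣ n → ∀ M : MarkedIdeal Y, IsDatum n M → IsNCHypStage n ⟨Y, M.ideal⟩ →
      ¬ (p = n ∧ IsNCHypStageJet p n ⟨Y, M.ideal⟩) → (p = n ∧ IsNCHypStageLat p ⟨Y, M.ideal⟩) →
        ∃ t : CentreSeq Y, WeakResolution t M

/-- **`WORNCHypWildRest3 n` — THE REMAINDER OF THE REMAINDER**: the binders of `WORNCHypWildRest2 n` verbatim PLUS
`¬ (p = n ∧ IsNCHypStageLat p)`.  UNDECIDED · TYPED WITH TEST DATA (module docstring, three families): (i) at `p = n = 2` the six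
Artin–Schreier-presentable data with an EVEN terminal label (Hauser's oblique kangaroo `x² + (1+xz)z²w²`, `b = (2,1)`;
`x² + (1+x+z)z²w²`; census (2,4) `1+x²+xz`, (4,4) `1+x+x²`, (4,4) `1+x²+xz`, (6,6) `1+x²+xw`) — «LatJet», IDEA-NEEDED;
(ii) `x² + (1+z³+w³)z²w²` — «polynomial-tail», IDEA-NEEDED; (iii) `n = p·m`, `m ≥ 2` (label datum `(3,3) ↦ 2 ↦ (2,2)`) — UNDECIDED.
[new] [cite: Hauser2010, §§3–5] -/
def WORNCHypWildRest3 (n : ℕ) : Prop :=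
  ∀ p : ℕ, p.Prime → ∀ (k : Type) [Field k] [CharP k p] (Y : Scheme.{0}) (g : Y ⟶ Spec (.of k)),
    IsBase Y g → p ∣ n → ∀ M : MarkedIdeal Y, IsDatum n M → IsNCHypStage n ⟨Y, M.ideal⟩ →
      ¬ (p = n ∧ IsNCHypStageJet p n ⟨Y, M.ideal⟩) → ¬ (p = n ∧ IsNCHypStageLat p ⟨Y, M.ideal⟩) →
        ∃ t : CentreSeq Y, WeakResolution t M

/-- ★ **THE CARVE OF THE REMAINDER BY THE LATENT CLASS (exact, hyp-free, pure logic)**: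
`WORNCHypWildRest2 n ⟺ WORNCHypWildLat n ∧ WORNCHypWildRest3 n`. [new] -/
theorem worNCHypWildRest2_iff_lat_rest3 (n : ℕ) : WORNCHypWildRest2 n ↔ WORNCHypWildLat n ∧ WORNCHypWildRest3 n := by
  constructor
  · intro h
    exact ⟨fun p hp k _ _ Y g hB hd M hM hS hc _ => h p hp k Y g hB hd M hM hS hc,
      fun p hp k _ _ Y g hB hd M hM hS hc _ => h p hp k Y g hB hd M hM hS hc⟩
  · rintro ⟨hL, hR⟩ p hp k _ _ Y g hB hd M hM hS hc
    by_cases hl : p = n ∧ IsNCHypStageLat p ⟨Y, M.ideal⟩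
    · exact hL p hp k Y g hB hd M hM hS hc hl
    · exact hR p hp k Y g hB hd M hM hS hc hl

/-- the FAMILY of latent cells (all markings `n ≥ 1`) -/
def E1NCHypWildLat : Prop := ∀ n : ℕ, 1 ≤ n → WORNCHypWildLat n

/-- the FAMILY of new remainders (all markings `n ≥ 1`): the column's LOCATED RESIDUAL after g36. UNDECIDED · typed with test data. -/
def E1NCHypWildRest3 : Prop := ∀ n : ℕ, 1 ≤ n → WORNCHypWildRest3 n

/-- families: `E1NCHypWildRest2 ⟺ E1NCHypWildLat ∧ E1NCHypWildRest3` (exact, pure logic). [new] -/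
theorem e1NCHypWildRest2_iff_lat_rest3 : E1NCHypWildRest2 ↔ E1NCHypWildLat ∧ E1NCHypWildRest3 :=
  ⟨fun h => ⟨fun n hn => ((worNCHypWildRest2_iff_lat_rest3 n).mp (h n hn)).1,
    fun n hn => ((worNCHypWildRest2_iff_lat_rest3 n).mp (h n hn)).2⟩,
    fun h n hn => (worNCHypWildRest2_iff_lat_rest3 n).mpr ⟨h.1 n hn, h.2 n hn⟩⟩

end Cells

/-! ### §Law — the bridge from the binders and the latent law -/

section Law

open AlgebraicGeometry.Scheme.IdealSheafData (vanishingIdeal)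

variable {Y : Scheme.{0}}

/-- **THE BRIDGE from a latent-contact frame to the list shape** (regular Noetherian `Y`, `p` prime vanishing in the stalks, marking
`p`): `ncHypShapeLat p Y E L 𝓘(H) M` for `E := (𝓘(H), 0) :: [(𝓘(Dᵢ), aᵢ)]ᵢ`, `L := (𝓘(H), 0) :: [(𝓘(Dᵢ), μᵢ)]ᵢ`. [new] [folklore] -/
theorem ncHypShapeLat_of_frame [IsNoetherian Y] (hY : Scheme.IsRegular Y) {p : ℕ} (hp : p.Prime)
    (hpY : ∀ y : Y, ((p : ℕ) : Y.presheaf.stalk y) = 0) {M : MarkedIdeal Y} (hμM : M.mult = p)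
    {F : NCFrame ⟨Y, M.ideal⟩} {μ : Fin F.r → ℕ} (hS : F.IsSNC) (hF : F.LatShape p μ) (hSupp : F.SuppLE p)
    (hlab : ∀ i, F.a i = 0 ∨ ¬ p ∣ F.a i) :
    vanishingIdeal F.H ∈ boundaryOf ((vanishingIdeal F.H, 0) :: F.expList) ∧
      HasSNC (vanishingIdeal F.H :: boundaryOf ((vanishingIdeal F.H, 0) :: F.expList)) ∧
      ncHypShapeLat p Y ((vanishingIdeal F.H, 0) :: F.expList) ((vanishingIdeal F.H, 0) :: (F.relabel μ).expList)
        (vanishingIdeal F.H) M := by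
  have hEs : HasSNC (vanishingIdeal F.H :: boundaryOf ((vanishingIdeal F.H, 0) :: F.expList)) := by
    refine hS.hasSNC_of_forall_mem hY fun K hK => ?_
    have hK : K = vanishingIdeal F.H ∨ K ∈ boundaryOf F.expList := by
      simpa only [List.map_cons, List.mem_cons, or_self_left] using hK
    rcases hK with rfl | hK
    · exact ⟨none, rfl⟩
    · obtain ⟨i, rfl⟩ := F.mem_boundaryOf_expList_iff.mp hK
      exact ⟨some i, rfl⟩
  refine ⟨List.mem_cons_self, hEs, hμM, hS.label_cons_expList, (hS.relabel μ).label_cons_expList, ?_, ?_, ?_, hp, hpY, ?_⟩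
  · -- the two boundary lists agree
    show boundaryOf ((vanishingIdeal F.H, 0) :: (F.relabel μ).expList) = boundaryOf ((vanishingIdeal F.H, 0) :: F.expList)
    simp only [boundaryOf, List.map_cons]
    exact congrArg _ (F.boundaryOf_expList_relabel μ)
  · -- the latent presentation along `V(𝓘(H)) = H`
    intro y hy
    obtain ⟨h, mb, mμ, c, v, hc, hv, hh, hb, hm, hI⟩ := hF y (mem_support_vanishingIdeal_iff.mp hy)
    refine ⟨h, mb, mμ, c, v, hc, hv, hh, ?_, ?_, hI⟩
    · rw [monomialIdeal_cons_zero, NCFrame.monomialIdeal_expList]; exact hb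
    · rw [monomialIdeal_cons_zero, NCFrame.monomialIdeal_expList]; exact hm
  · -- `supp(M) ⊆ V(𝓘(H))`
    intro y hy
    rw [SetLike.mem_coe, mem_support_vanishingIdeal_iff]
    refine hSupp y ((le_idealOrder_iff M.ideal y p).mpr ?_)
    have := (MarkedIdeal.mem_support_iff M y).mp hy
    rwa [hμM] at this
  · -- T18's coprime clause on the terminal exponents
    intro K y _
    rcases F.expOf_cons_expList (NCFrame.eq_of_vanishingIdeal_eq hS) K with h0 | ⟨i, hi⟩
    · exact Or.inl h0
    · rw [hi]; exact hlab i

/-- **THE BRIDGE from the binders**: a base `p`-datum over a field of characteristic `p` whose stage is a latent-contact n.c. stage is a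
`ncHypShapeLat p`-datum with `H :: ∂E` s.n.c. and `H ∈ ∂E`. [new] [folklore] -/
theorem exists_ncHypShapeLat_of_isNCHypStageLat {p : ℕ} (hp : p.Prime) {k : Type} [Field k] [CharP k p]
    (g : Y ⟶ Spec (.of k)) (hB : IsBase Y g) {M : MarkedIdeal Y} (hM : IsDatum p M) (hNC : IsNCHypStageLat p ⟨Y, M.ideal⟩) :
    ∃ (E L : List (Y.IdealSheafData × ℕ)) (H : Y.IdealSheafData),
      HasSNC (H :: boundaryOf E) ∧ H ∈ boundaryOf E ∧ ncHypShapeLat p Y E L H M := by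
  haveI := hB.locallyOfFiniteType
  haveI := hB.quasiCompact
  haveI : IsLocallyNoetherian Y := LocallyOfFiniteType.isLocallyNoetherian g
  haveI : CompactSpace Y := QuasiCompact.compactSpace_of_compactSpace g
  haveI : IsNoetherian Y := {}
  obtain ⟨F, μ, hS, hF, hSupp, hlab⟩ := hNC
  obtain ⟨hH, hEs, hP⟩ := ncHypShapeLat_of_frame hB.isRegular hp (natCast_stalk_eq_zero_of_charP p g) hM.1 hS hF hSupp hlab
  exact ⟨_, _, _, hEs, hH, hP⟩

/-- ★★ **THE LATENT LAW, frame level, hyp-free**: over a field of characteristic `p`, a base `p`-datum whose stage is a LATENT-CONTACT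
n.c. stage admits a weak resolution. [new] [cite: CossartPiltant2008, Prop. 4.2] [cite: Kollar2007, (3.111) Step 3] -/
theorem worLatent_holds {p : ℕ} (hp : p.Prime) {k : Type} [Field k] [CharP k p] (g : Y ⟶ Spec (.of k)) (hB : IsBase Y g)
    (M : MarkedIdeal Y) (hM : IsDatum p M) (hNC : IsNCHypStageLat p ⟨Y, M.ideal⟩) : ∃ t : CentreSeq Y, WeakResolution t M := by
  haveI := hB.locallyOfFiniteType
  haveI := hB.quasiCompact
  haveI : IsLocallyNoetherian Y := LocallyOfFiniteType.isLocallyNoetherian g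
  obtain ⟨E, L, H, hEs, hH, hP⟩ := exists_ncHypShapeLat_of_isNCHypStageLat hp g hB hM hNC
  exact hP.exists_weakResolution hEs hH

/-- the latent cell at EVERY level `n` (composite and zero levels are vacuous: `p = n` with `p` prime). [new] -/
theorem worNCHypWildLat_all (n : ℕ) : WORNCHypWildLat n := by
  intro p hp k _ _ Y g hB _ M hM _ _ hl
  obtain ⟨hpn, hNC⟩ := hl
  subst hpn
  exact worLatent_holds hp g hB M hM hNC

/-- ★★ **THE LATENT CELL IS DECIDED · HOLDS** — `WORNCHypWildLat n` for every `n ≥ 1`: at the pure-characteristic marking `p = n`, a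
base `n`-datum whose stage is a LATENT-CONTACT s.n.c. stage admits a weak resolution — latent hops at the codimension-two faces
`V(H) ∩ V(K)` (L20c) until the latent mass vanishes, then the jet law (T19b).  The cell `WORNCHypWildLat` of the carving
`worNCHypWildRest2_iff_lat_rest3` is DECIDED · HOLDS; `WORNCHypWildRest3` stays UNDECIDED. [new] [cite: CossartPiltant2008, Prop. 4.2]
[cite: Kollar2007, (3.111) Step 3] [cite: Hauser2010, §5] -/
theorem worNCHypWildLat_holds (n : ℕ) (_hn : 1 ≤ n) : WORNCHypWildLat n := worNCHypWildLat_all n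

/-- the FAMILY of latent cells holds. [new] -/
theorem e1NCHypWildLat_holds : E1NCHypWildLat := worNCHypWildLat_holds

-- the law, fully qualified, binders `n` / `1 ≤ n` only.
example (n : ℕ) (hn : 1 ≤ n) : Summit.ResolutionOfSingularities.ResolutionOfSingularities.Theorems.DeltaCutClasses.WORNCHypWildLat n :=
  worNCHypWildLat_holds n hn

example : WORNCHypWildLat 4 := fun p hp _ _ _ _ _ _ _ _ _ _ _ h4 => absurd (h4.1 ▸ hp) (by decide)

/-- ★ **THE REMAINDER IS ITS NEW REMAINDER (exact)**: `WORNCHypWildRest2 n ⟺ WORNCHypWildRest3 n`. [new] -/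
theorem worNCHypWildRest2_iff_rest3 (n : ℕ) : WORNCHypWildRest2 n ↔ WORNCHypWildRest3 n := by
  rw [worNCHypWildRest2_iff_lat_rest3]
  exact ⟨fun h => h.2, fun h => ⟨worNCHypWildLat_all n, h⟩⟩

/-- ★ per level, the wild cell reduces to the new remainder: `WORNCHypWild n ⟺ WORNCHypWildRest3 n` (exact). [new] -/
theorem worNCHypWild_iff_rest3 (n : ℕ) : WORNCHypWild n ↔ WORNCHypWildRest3 n :=
  (worNCHypWild_iff_rest2 n).trans (worNCHypWildRest2_iff_rest3 n)

/-- per level: `WORNCHypWildRest3 n → WORNCHyp n`. [new] -/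
theorem worNCHyp_of_wildRest3 {n : ℕ} (hn : 1 ≤ n) (hR : WORNCHypWildRest3 n) : WORNCHyp n :=
  worNCHyp_of_wildRest2 hn ((worNCHypWildRest2_iff_rest3 n).mpr hR)

/-- families: `E1NCHypWildRest2 ⟺ E1NCHypWildRest3` (exact). [new] -/
theorem e1NCHypWildRest2_iff_rest3 : E1NCHypWildRest2 ↔ E1NCHypWildRest3 :=
  ⟨fun h n hn => (worNCHypWildRest2_iff_rest3 n).mp (h n hn), fun h n hn => (worNCHypWildRest2_iff_rest3 n).mpr (h n hn)⟩

/-- families: `E1NCHypWild ⟺ E1NCHypWildRest3` (exact). [new] -/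
theorem e1NCHypWild_iff_rest3 : E1NCHypWild ↔ E1NCHypWildRest3 := e1NCHypWild_iff_rest2.trans e1NCHypWildRest2_iff_rest3

/-- families: `E1NCHypWildRest3 → E1NCHyp`. [new] -/
theorem e1NCHyp_of_wildRest3 (hR : E1NCHypWildRest3) : E1NCHyp := e1NCHyp_of_wildRest2 (e1NCHypWildRest2_iff_rest3.mpr hR)

end Law

/-! ### §Carve — the column's carve with the latent cell DISCHARGED -/

section Carve

open SubfieldContactClasses

/-- exact remainder form: `E1NCHypWildRest3 → E1TopSHeavyOffNC → E1TopSHeavy`. [new] -/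
theorem e1TopSHeavy_of_wildRest3_offNC (hR : E1NCHypWildRest3) (hO : E1TopSHeavyOffNC) : E1TopSHeavy :=
  e1TopSHeavy_of_wildRest2_offNC (e1NCHypWildRest2_iff_rest3.mpr hR) hO

/-- edge to the column item (26971): under `SubfieldContactAbs` and `E 5`,
`E1NCHypWildRest3 → E1NCEntryPerpetual → E1TopSFrozenOffNC → E1TopNoAbs`. [new] -/
theorem e1TopNoAbs_of_wildRest3 (hSC : SubfieldContactAbs) (h5 : E 5) (hR : E1NCHypWildRest3) (hE : E1NCEntryPerpetual)
    (hO : E1TopSFrozenOffNC) : E1TopNoAbs :=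
  e1TopNoAbs_of_wildRest2 hSC h5 (e1NCHypWildRest2_iff_rest3.mpr hR) hE hO

/-- edge to the live aside (item 27045): under `E 5`,
`E1NCHypWildRest3 → E1NCEntryPerpetual → E1TopSFrozenOffNC → E1TopGHeavy`. [new] -/
theorem e1TopGHeavy_of_wildRest3 (h5 : E 5) (hR : E1NCHypWildRest3) (hE : E1NCEntryPerpetual) (hO : E1TopSFrozenOffNC) :
    E1TopGHeavy :=
  e1TopGHeavy_of_wildRest2 h5 (e1NCHypWildRest2_iff_rest3.mpr hR) hE hO

end Carve

end Summit.ResolutionOfSingularities.ResolutionOfSingularities.Theorems.DeltaCutClasses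

end
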